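import Summits.AtomisticToContinuum.Crystallization.Theorems.OverbindingBudgetAffineHcpReference

/-!
# The pinned Gram chart of a far window (NODE 68, deliverable (K5), part 1: chart, scale, region, membership)

Z2-leaf `hcert` of `…OverbindingBudgetAffineFarSmoothSplit.farCoreExcess_of_hcpEnclosures` quantifies over all sign windows
`w` and ALL linear maps `X : E3 →ₗ[ℝ] E3` with `FarWindowData (1/25) (1/2000 − τ) w X`.  The chart dictionary of the sibling
module `…OverbindingBudgetAffineRadialGlue` (`ChartDictionary`) asks, per window, for a chart map, a normalising length and
five obligations.  This file CONSTRUCTS the window-independent half of that data and proves the two obligations that do not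
involve the lattice sums:

* §1 reduced coordinates: every structure point is `layerVec i j o k = (i + o/3)·b₀ + (j + o/3)·b₁ + k·b₂` for the FIXED
  reduced basis `b = (u, v, √(2/3) e₃)` (`redBasis`, `redVec`, `layerVec_eq_redVec`, `wPos_eq_redVec`);
* §2 the Gram data of `X` in that basis and the exact identity `‖X (redVec n)‖² = Σ nₐ n_b ⟪X bₐ, X b_b⟫` (`normSq_redVec`);
* §3 the CHART: the normalising length `chartScale X = ‖X b₀‖` (the image length of ONE fixed first-shell vector — the family
  ratio `ψ = N/P²` is homogeneous of degree `0`, so no case analysis on which first-shell vector is the shortest is needed) and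
  the five PINNED GRAM OFFSETS `gramChart X ∈ E5` (`G₀₀ = 1` pinned; offsets of `G₀₁, G₀₂, G₁₁, G₁₂, G₂₂` from the ideal hcp
  metric `gramRef = [[1,½,0],[½,1,0],[0,0,⅔]]`); the AFFINE quadratic form `chartForm x n = refForm n + Σᵢ xᵢ·chartFormLin n i` of a chart point and
  the EXACT dictionary identity `‖X (redVec n)‖² = chartScale X² · chartForm (gramChart X) n` (`normSq_redVec_eq_chart`): the squared
  image length of every lattice vector is the normalising length squared times an AFFINE function of the chart point — this is
  what makes the near family of the Z2 tables an inverse-power family `Σ (c_v + L_v·x)^{-p/2}` (`FamilyData` of the sibling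
  `…RadialReduction`), with `c_v = refForm (N_v/3)` and `L_v = chartFormLin (N_v/3)` read off here (`refForm_wIdx`, `normSq_wPos_eq_chart`);
* §4 the REGION `KRegion Λ = {x | ∀ n m, chartForm x n · refForm m ≤ Λ · chartForm x m · refForm n}` (anisotropy of `G(x)` relative to `gramRef` at
  most `Λ`): CONVEX (`convex_KRegion`, hence star-convex about any of its points, `starConvex_KRegion`) and containing the
  ideal point `0` when `1 ≤ Λ`;
* §5 MEMBERSHIP FROM ADMISSIBILITY (`gramChart_mem_KRegion`): the near-isometry clause of `FarWindowData θ θ' w X`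
  (`∃ Q isometry, ‖X v − Q v‖ ≤ 3θ‖v‖`) puts `gramChart X` in `KRegion ((1+3θ)/(1−3θ))²` — for `θ = 1/25` the anisotropy cap
  `(28/22)²`; and the normalising length is positive (`chartScale_pos_of_near`).  These discharge the fields `scale_pos` and
  `mem_K` of `ChartDictionary` for EVERY window at once (`scale_pos_of_farWindowData`, `mem_K_of_farWindowData`).

What is NOT here (g69): the fields `far` (the far clause excludes the Gram ball `‖x − x₀‖ < r₁`, via the tree's Gram ⇒
near-isometry witnesses `norm_sub_smul_le_of_gram` / `not_farShape_of_near`) and `upper` / `lower` (the window sums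
`windowSixUp` / `windowTwelveLo` against the finite near family plus certified far-field constants, via `layerSum_far_le`).
Only axioms `propext`, `Classical.choice`, `Quot.sound`; no `sorry`; every `def` is data (no `def … : Prop`).
-/

noncomputable section

namespace Summit.AtomisticToContinuum.Crystallization.Theorems.OverbindingBudgetAffineRadialChart

open scoped BigOperators
open Summit.AtomisticToContinuum.Crystallization.Theorems.OverbindingBudgetAffineFarSmoothSplit

local notation "E3" => EuclideanSpace ℝ (Fin 3)
local notation "E5" => EuclideanSpace ℝ (Fin 5)

/-! ## §1 Reduced coordinates -/

/-- The REDUCED BASIS `b₀ = u = layerVec 1 0 0 0`, `b₁ = v = layerVec 0 1 0 0`, `b₂ = √(2/3)·e₃ = layerVec 0 0 0 1`. -/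
def redBasis : Fin 3 → E3 := ![layerVec 1 0 0 0, layerVec 0 1 0 0, layerVec 0 0 0 1]

/-- The vector with reduced coordinates `n`: `Σₐ nₐ • bₐ`. -/
def redVec (n : Fin 3 → ℝ) : E3 := ∑ a : Fin 3, n a • redBasis a

/-- `redVec n = n₀ b₀ + n₁ b₁ + n₂ b₂`. [formal bookkeeping] -/
theorem redVec_eq (n : Fin 3 → ℝ) :
    redVec n = n 0 • layerVec 1 0 0 0 + n 1 • layerVec 0 1 0 0 + n 2 • layerVec 0 0 0 1 := by
  simp [redVec, redBasis, Fin.sum_univ_three]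

/-- Coordinate `0` of `redVec n`: `n₀ + n₁/2`. [formal bookkeeping] -/
@[simp] theorem redVec_apply_zero (n : Fin 3 → ℝ) : redVec n 0 = n 0 + n 1 / 2 := by
  rw [redVec_eq]; simp; ring

/-- Coordinate `1` of `redVec n`: `(√3/2)·n₁`. [formal bookkeeping] -/
@[simp] theorem redVec_apply_one (n : Fin 3 → ℝ) : redVec n 1 = Real.sqrt 3 / 2 * n 1 := by
  rw [redVec_eq]; simp; ring

/-- Coordinate `2` of `redVec n`: `n₂·√(2/3)`. [formal bookkeeping] -/
@[simp] theorem redVec_apply_two (n : Fin 3 → ℝ) : redVec n 2 = n 2 * Real.sqrt (2 / 3) := by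
  rw [redVec_eq]; simp

/-- The REDUCED COORDINATES of the layer point `(i, j, o, k)`: `(i + o/3, j + o/3, k)`. -/
def redIdx (i j o k : ℤ) : Fin 3 → ℝ := ![(i : ℝ) + o / 3, (j : ℝ) + o / 3, k]

/-- Every layer point is a reduced-coordinate vector: `layerVec i j o k = redVec (i + o/3, j + o/3, k)`. [this file] -/
theorem layerVec_eq_redVec (i j o k : ℤ) : layerVec i j o k = redVec (redIdx i j o k) := by
  ext l
  fin_cases l
  · show layerVec i j o k 0 = redVec (redIdx i j o k) 0
    rw [layerVec_apply_zero', redVec_apply_zero]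
    simp only [redIdx, Matrix.cons_val_zero, Matrix.cons_val_one]; ring
  · show layerVec i j o k 1 = redVec (redIdx i j o k) 1
    rw [layerVec_apply_one', redVec_apply_one]
    simp only [redIdx, Matrix.cons_val_one, Matrix.cons_val_zero]
  · show layerVec i j o k 2 = redVec (redIdx i j o k) 2
    rw [layerVec_apply_two', redVec_apply_two]
    simp only [redIdx, Matrix.cons_val_two, Matrix.tail_cons, Matrix.head_cons]

/-- The reduced coordinates of the window point `wPos w t`, `t = (k, i, j)`: `redIdx i j (windowLabel w k) k`. -/
def wIdx (w : Fin 6 → ℤ) (t : ℤ × ℤ × ℤ) : Fin 3 → ℝ := redIdx t.2.1 t.2.2 (windowLabel w t.1) t.1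

/-- Every window point is a reduced-coordinate vector. [this file] -/
theorem wPos_eq_redVec (w : Fin 6 → ℤ) (t : ℤ × ℤ × ℤ) : wPos w t = redVec (wIdx w t) :=
  layerVec_eq_redVec _ _ _ _

/-! ## §2 The Gram data of a linear map in the reduced basis -/

/-- The Gram entry `⟪X bₐ, X b_b⟫`. -/
def gramEntry (X : E3 →ₗ[ℝ] E3) (a b : Fin 3) : ℝ := inner ℝ (X (redBasis a)) (X (redBasis b))

/-- `gramEntry` is symmetric. [formal bookkeeping] -/
theorem gramEntry_comm (X : E3 →ₗ[ℝ] E3) (a b : Fin 3) : gramEntry X a b = gramEntry X b a :=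
  real_inner_comm _ _

/-- `gramEntry X a a = ‖X bₐ‖²`. [formal bookkeeping] -/
theorem gramEntry_self (X : E3 →ₗ[ℝ] E3) (a : Fin 3) : gramEntry X a a = ‖X (redBasis a)‖ ^ 2 :=
  real_inner_self_eq_norm_sq _

/-- The EXACT expansion `‖X (redVec n)‖² = Σₐ Σ_b nₐ n_b ⟪X bₐ, X b_b⟫`. [this file] -/
theorem normSq_redVec (X : E3 →ₗ[ℝ] E3) (n : Fin 3 → ℝ) :
    ‖X (redVec n)‖ ^ 2 = ∑ a : Fin 3, ∑ b : Fin 3, n a * n b * gramEntry X a b := by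
  have h : X (redVec n) = ∑ a : Fin 3, n a • X (redBasis a) := by
    simp [redVec, map_sum, map_smul]
  rw [h, norm_sq_sum_smul]; rfl

/-- The identity map has Gram data `gramRef`: `⟪bₐ, b_b⟫ = [[1,½,0],[½,1,0],[0,0,⅔]]`. -/
def gramRef : Fin 3 → Fin 3 → ℝ := ![![1, 1 / 2, 0], ![1 / 2, 1, 0], ![0, 0, 2 / 3]]

/-- The inner product of `E3` in coordinates. [formal bookkeeping] -/
private theorem inner_eq_sum3 (u v : E3) : inner ℝ u v = u 0 * v 0 + u 1 * v 1 + u 2 * v 2 := by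
  simp [PiLp.inner_apply, Fin.sum_univ_three, mul_comm]

/-- The inner product of two layer points in closed form:
`⟪layerVec i j o k, layerVec i' j' o' k'⟫ = (i + j/2 + o/2)(i' + j'/2 + o'/2) + ¾ (j + o/3)(j' + o'/3) + ⅔ k k'`. [this file] -/
theorem inner_layerVec (i j o k i' j' o' k' : ℤ) :
    inner ℝ (layerVec i j o k) (layerVec i' j' o' k') =
      ((i : ℝ) + j / 2 + o / 2) * (i' + j' / 2 + o' / 2) + 3 / 4 * ((j : ℝ) + o / 3) * (j' + o' / 3) + 2 / 3 * k * k' := by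
  have h3 : Real.sqrt 3 * Real.sqrt 3 = 3 := Real.mul_self_sqrt (by norm_num)
  have h23 : Real.sqrt (2 / 3) * Real.sqrt (2 / 3) = 2 / 3 := Real.mul_self_sqrt (by norm_num)
  rw [inner_eq_sum3, layerVec_apply_zero', layerVec_apply_one', layerVec_apply_two', layerVec_apply_zero',
    layerVec_apply_one', layerVec_apply_two']
  linear_combination (1 / 4 * ((j : ℝ) + o / 3) * (j' + o' / 3)) * h3 + ((k : ℝ) * k') * h23

/-- `⟪bₐ, b_b⟫ = gramRef a b`. [this file] -/
theorem inner_redBasis (a b : Fin 3) : inner ℝ (redBasis a) (redBasis b) = gramRef a b := by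
  fin_cases a <;> fin_cases b <;>
    simp only [redBasis, gramRef, Fin.zero_eta, Fin.mk_one, Fin.reduceFinMk, Fin.isValue, Matrix.cons_val_zero,
      Matrix.cons_val_one, Matrix.cons_val_two, Matrix.head_cons, Matrix.tail_cons] <;>
    rw [inner_layerVec] <;> push_cast <;> ring

/-- `‖redVec n‖² = Σₐ Σ_b nₐ n_b gramRef a b`. [this file] -/
theorem normSq_redVec_id (n : Fin 3 → ℝ) :
    ‖redVec n‖ ^ 2 = ∑ a : Fin 3, ∑ b : Fin 3, n a * n b * gramRef a b := by
  rw [redVec, norm_sq_sum_smul]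
  simp only [inner_redBasis]

/-! ## §3 The chart: normalising length, pinned Gram offsets, the affine quadratic form -/

/-- The NORMALISING LENGTH of the chart: the image length of the fixed first-shell vector `b₀ = u`. -/
def chartScale (X : E3 →ₗ[ℝ] E3) : ℝ := ‖X (redBasis 0)‖

/-- `chartScale X ^ 2 = gramEntry X 0 0`. [formal bookkeeping] -/
theorem chartScale_sq (X : E3 →ₗ[ℝ] E3) : chartScale X ^ 2 = gramEntry X 0 0 := (gramEntry_self X 0).symm

/-- The CHART POINT of `X`: the five pinned Gram offsets
`(G₀₁ − ½, G₀₂, G₁₁ − 1, G₁₂, G₂₂ − ⅔)` of the normalised Gram matrix `G = (⟪X bₐ, X b_b⟫ / ‖X b₀‖²)` (so `G₀₀ = 1`). -/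
def gramChart (X : E3 →ₗ[ℝ] E3) : E5 :=
  WithLp.toLp 2 ![gramEntry X 0 1 / chartScale X ^ 2 - 1 / 2, gramEntry X 0 2 / chartScale X ^ 2,
    gramEntry X 1 1 / chartScale X ^ 2 - 1, gramEntry X 1 2 / chartScale X ^ 2, gramEntry X 2 2 / chartScale X ^ 2 - 2 / 3]

/-- The symmetric matrix of a chart point: `G(x) = gramRef + offsets`, `G₀₀ = 1` pinned. -/
def gramOfChart (x : E5) : Fin 3 → Fin 3 → ℝ :=
  ![![1, 1 / 2 + x 0, x 1], ![1 / 2 + x 0, 1 + x 2, x 3], ![x 1, x 3, 2 / 3 + x 4]]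

/-- The QUADRATIC FORM of a chart point at reduced coordinates `n`: `nᵀ G(x) n`. -/
def chartForm (x : E5) (n : Fin 3 → ℝ) : ℝ := ∑ a : Fin 3, ∑ b : Fin 3, n a * n b * gramOfChart x a b

/-- The reference quadratic form `nᵀ gramRef n = n₀² + n₀n₁ + n₁² + ⅔ n₂²` (the constant term `c_v` of the family). -/
def refForm (n : Fin 3 → ℝ) : ℝ := n 0 ^ 2 + n 0 * n 1 + n 1 ^ 2 + 2 / 3 * n 2 ^ 2

/-- The LINEAR PART of the family at reduced coordinates `n`: `L_v = (2n₀n₁, 2n₀n₂, n₁², 2n₁n₂, n₂²)`. -/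
def chartFormLin (n : Fin 3 → ℝ) : Fin 5 → ℝ := ![2 * n 0 * n 1, 2 * n 0 * n 2, n 1 ^ 2, 2 * n 1 * n 2, n 2 ^ 2]

/-- The quadratic form is AFFINE in the chart point: `chartForm x n = refForm n + Σᵢ xᵢ · chartFormLin n i`. [this file] -/
theorem chartForm_eq_affine (x : E5) (n : Fin 3 → ℝ) : chartForm x n = refForm n + ∑ i : Fin 5, x i * chartFormLin n i := by
  simp only [chartForm, refForm, chartFormLin, gramOfChart, Fin.sum_univ_three, Fin.sum_univ_five]
  simp
  ring

/-- `refForm n = ‖redVec n‖²`: the reference form IS the squared length. [this file] -/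
theorem refForm_eq_normSq (n : Fin 3 → ℝ) : refForm n = ‖redVec n‖ ^ 2 := by
  rw [normSq_redVec_id]
  simp only [refForm, gramRef, Fin.sum_univ_three]
  simp
  ring

/-- At the ideal point the form is the reference form: `chartForm 0 n = refForm n`. [formal bookkeeping] -/
theorem chartForm_zero (n : Fin 3 → ℝ) : chartForm 0 n = refForm n := by
  rw [chartForm_eq_affine]; simp

/-- ★ THE DICTIONARY IDENTITY: `gramOfChart (gramChart X) a b · chartScale X² = gramEntry X a b` — the chart point encodes the
whole Gram matrix of `X` up to the normalising length (needs `chartScale X ≠ 0`). [this file] -/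
theorem gramOfChart_gramChart {X : E3 →ₗ[ℝ] E3} (hX : chartScale X ≠ 0) (a b : Fin 3) :
    gramOfChart (gramChart X) a b * chartScale X ^ 2 = gramEntry X a b := by
  have hs : chartScale X ^ 2 ≠ 0 := pow_ne_zero 2 hX
  have h00 := chartScale_sq X
  have h10 := gramEntry_comm X 1 0
  have h20 := gramEntry_comm X 2 0
  have h21 := gramEntry_comm X 2 1
  fin_cases a <;> fin_cases b <;> simp [gramOfChart, gramChart] <;> field_simp <;> linarith

/-- ★ `‖X (redVec n)‖² = chartScale X² · chartForm (gramChart X) n`: the squared image length of every reduced-coordinate vector is the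
normalising length squared times an AFFINE function of the chart point. [this file] -/
theorem normSq_redVec_eq_chart {X : E3 →ₗ[ℝ] E3} (hX : chartScale X ≠ 0) (n : Fin 3 → ℝ) :
    ‖X (redVec n)‖ ^ 2 = chartScale X ^ 2 * chartForm (gramChart X) n := by
  rw [normSq_redVec, chartForm, Finset.mul_sum]
  refine Finset.sum_congr rfl fun a _ => ?_
  rw [Finset.mul_sum]
  refine Finset.sum_congr rfl fun b _ => ?_
  rw [← gramOfChart_gramChart hX a b]; ring

/-- ★ The near family of a window in chart form: `‖X (wPos w t)‖² = chartScale X² · (refForm (wIdx w t) + Σᵢ (gramChart X)ᵢ · chartFormLin (wIdx w t) i)`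
— the window point `t` contributes the affine form with constant `c_t = refForm (wIdx w t) = ‖wPos w t‖²` and linear part
`L_t = chartFormLin (wIdx w t)`. [this file] -/
theorem normSq_wPos_eq_chart {X : E3 →ₗ[ℝ] E3} (hX : chartScale X ≠ 0) (w : Fin 6 → ℤ) (t : ℤ × ℤ × ℤ) :
    ‖X (wPos w t)‖ ^ 2 = chartScale X ^ 2 * (refForm (wIdx w t) + ∑ i : Fin 5, gramChart X i * chartFormLin (wIdx w t) i) := by
  rw [wPos_eq_redVec, normSq_redVec_eq_chart hX, chartForm_eq_affine]

/-- `refForm (wIdx w t) = ‖wPos w t‖²`. [formal bookkeeping] -/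
theorem refForm_wIdx (w : Fin 6 → ℤ) (t : ℤ × ℤ × ℤ) : refForm (wIdx w t) = ‖wPos w t‖ ^ 2 := by
  rw [refForm_eq_normSq, wPos_eq_redVec]

/-! ## §4 The chart region: anisotropy relative to the reference metric -/

/-- The CHART REGION of anisotropy cap `Λ`: `G(x) ≤ Λ·G(x)` in every pair of directions relative to `gramRef`, i.e.
`chartForm x n · refForm m ≤ Λ · chartForm x m · refForm n` for all `n, m` (for `G(x)` positive definite: the ratio of the extreme generalised
eigenvalues of `G(x)` w.r.t. `gramRef` is at most `Λ`).  An intersection of half-spaces in `x`. -/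
def KRegion (Λ : ℝ) : Set E5 := {x | ∀ n m : Fin 3 → ℝ, chartForm x n * refForm m ≤ Λ * (chartForm x m * refForm n)}

/-- The quadratic form along an affine combination of chart points. [this file] -/
theorem chartForm_affineCombo (x y : E5) {a b : ℝ} (hab : a + b = 1) (n : Fin 3 → ℝ) :
    chartForm (a • x + b • y) n = a * chartForm x n + b * chartForm y n := by
  rw [chartForm_eq_affine, chartForm_eq_affine, chartForm_eq_affine]
  have hsum : ∑ i : Fin 5, (a • x + b • y) i * chartFormLin n i = a * ∑ i : Fin 5, x i * chartFormLin n i + b * ∑ i : Fin 5, y i * chartFormLin n i := by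
    rw [Finset.mul_sum, Finset.mul_sum, ← Finset.sum_add_distrib]
    refine Finset.sum_congr rfl fun i _ => ?_
    rw [PiLp.add_apply, PiLp.smul_apply, PiLp.smul_apply, smul_eq_mul, smul_eq_mul]; ring
  rw [hsum]
  linear_combination (-refForm n) * hab

/-- ★ The chart region is CONVEX. [this file] -/
theorem convex_KRegion (Λ : ℝ) : Convex ℝ (KRegion Λ) := by
  intro x hx y hy a b ha hb hab n m
  rw [chartForm_affineCombo x y hab n, chartForm_affineCombo x y hab m]
  have h1 := hx n m
  have h2 := hy n m
  nlinarith [mul_le_mul_of_nonneg_left h1 ha, mul_le_mul_of_nonneg_left h2 hb]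

/-- Hence star-convex about each of its points (the hypothesis `hK` of `…RadialGlue.table_of_radialTables`). [this file] -/
theorem starConvex_KRegion (Λ : ℝ) {x₀ : E5} (h : x₀ ∈ KRegion Λ) : StarConvex ℝ x₀ (KRegion Λ) :=
  (convex_KRegion Λ).starConvex h

/-- The ideal point lies in the region as soon as `1 ≤ Λ`. [this file] -/
theorem zero_mem_KRegion {Λ : ℝ} (hΛ : 1 ≤ Λ) : (0 : E5) ∈ KRegion Λ := by
  intro n m
  rw [chartForm_zero, chartForm_zero]
  have h0 : 0 ≤ refForm n * refForm m := by rw [refForm_eq_normSq, refForm_eq_normSq]; positivity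
  nlinarith

/-! ## §5 Membership and positivity from the near-isometry clause -/

/-- Two-sided length control from the near-isometry clause: `(1 − 3θ)‖v‖ ≤ ‖X v‖ ≤ (1 + 3θ)‖v‖`. [this file] -/
theorem norm_bounds_of_nearIsometry {θ : ℝ} {X : E3 →ₗ[ℝ] E3} (hQ : ∃ Q : E3 →ₗᵢ[ℝ] E3, ∀ v : E3, ‖X v - Q v‖ ≤ 3 * θ * ‖v‖)
    (v : E3) : (1 - 3 * θ) * ‖v‖ ≤ ‖X v‖ ∧ ‖X v‖ ≤ (1 + 3 * θ) * ‖v‖ := by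
  obtain ⟨Q, hQ⟩ := hQ
  have h := hQ v
  have hq : ‖Q v‖ = ‖v‖ := Q.norm_map v
  constructor
  · have := norm_sub_norm_le (Q v) (X v)
    rw [norm_sub_rev] at this
    linarith
  · have := norm_le_insert' (X v) (Q v)
    linarith

/-- The normalising length is positive under the near-isometry clause (`3θ < 1`; `‖b₀‖ = 1`). [this file] -/
theorem chartScale_pos_of_near {θ : ℝ} (hθ : 3 * θ < 1) {X : E3 →ₗ[ℝ] E3}
    (hQ : ∃ Q : E3 →ₗᵢ[ℝ] E3, ∀ v : E3, ‖X v - Q v‖ ≤ 3 * θ * ‖v‖) : 0 < chartScale X := by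
  have hb : ‖redBasis 0‖ = 1 := by
    have h := three_mul_norm_sq_layerVec 1 0 0 0
    push_cast at h
    have hn : 0 ≤ ‖layerVec 1 0 0 0‖ := norm_nonneg _
    have : ‖layerVec 1 0 0 0‖ = 1 := by nlinarith
    simpa [redBasis] using this
  have h := (norm_bounds_of_nearIsometry hQ (redBasis 0)).1
  rw [hb, mul_one] at h
  unfold chartScale; linarith

/-- ★ MEMBERSHIP FROM ADMISSIBILITY: under the near-isometry clause with `3θ < 1` the chart point lies in the region of
anisotropy cap `((1 + 3θ)/(1 − 3θ))²` (for `θ = 1/25`: `(28/22)²`). [this file] -/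
theorem gramChart_mem_KRegion {θ : ℝ} (hθ : 3 * θ < 1) {X : E3 →ₗ[ℝ] E3}
    (hQ : ∃ Q : E3 →ₗᵢ[ℝ] E3, ∀ v : E3, ‖X v - Q v‖ ≤ 3 * θ * ‖v‖) :
    gramChart X ∈ KRegion (((1 + 3 * θ) / (1 - 3 * θ)) ^ 2) := by
  have hs : 0 < chartScale X := chartScale_pos_of_near hθ hQ
  have hs2 : 0 < chartScale X ^ 2 := pow_pos hs 2
  have h1θ : 0 < 1 - 3 * θ := by linarith
  have hθ0 : 0 ≤ 1 + 3 * θ := by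
    have := (norm_bounds_of_nearIsometry hQ (redBasis 0)).2
    have h' := (norm_bounds_of_nearIsometry hQ (redBasis 0)).1
    nlinarith [norm_nonneg (redBasis 0), norm_nonneg (X (redBasis 0)), hs, show chartScale X = ‖X (redBasis 0)‖ from rfl]
  intro n m
  -- translate to lengths
  have en : chartForm (gramChart X) n = ‖X (redVec n)‖ ^ 2 / chartScale X ^ 2 := by
    rw [normSq_redVec_eq_chart hs.ne' n]; field_simp
  have em : chartForm (gramChart X) m = ‖X (redVec m)‖ ^ 2 / chartScale X ^ 2 := by
    rw [normSq_redVec_eq_chart hs.ne' m]; field_simp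
  rw [en, em, refForm_eq_normSq, refForm_eq_normSq]
  obtain ⟨hnlo, hnhi⟩ := norm_bounds_of_nearIsometry hQ (redVec n)
  obtain ⟨hmlo, hmhi⟩ := norm_bounds_of_nearIsometry hQ (redVec m)
  -- ‖X rn‖² ‖rm‖² ≤ (1+3θ)² ‖rn‖² ‖rm‖² and (1-3θ)² ‖rm‖² ≤ ‖X rm‖²
  have hA : ‖X (redVec n)‖ ^ 2 ≤ (1 + 3 * θ) ^ 2 * ‖redVec n‖ ^ 2 := by
    rw [← mul_pow]; exact pow_le_pow_left₀ (norm_nonneg _) hnhi 2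
  have hB : (1 - 3 * θ) ^ 2 * ‖redVec m‖ ^ 2 ≤ ‖X (redVec m)‖ ^ 2 := by
    rw [← mul_pow]; exact pow_le_pow_left₀ (by positivity) hmlo 2
  rw [div_mul_eq_mul_div, div_le_iff₀ hs2]
  have key : ‖X (redVec n)‖ ^ 2 * ‖redVec m‖ ^ 2 ≤
      ((1 + 3 * θ) / (1 - 3 * θ)) ^ 2 * (‖X (redVec m)‖ ^ 2 * ‖redVec n‖ ^ 2) := by
    have h1 : ‖X (redVec n)‖ ^ 2 * ‖redVec m‖ ^ 2 ≤ (1 + 3 * θ) ^ 2 * ‖redVec n‖ ^ 2 * ‖redVec m‖ ^ 2 :=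
      mul_le_mul_of_nonneg_right hA (by positivity)
    have h2 : (1 + 3 * θ) ^ 2 * ‖redVec n‖ ^ 2 * ‖redVec m‖ ^ 2 ≤
        ((1 + 3 * θ) / (1 - 3 * θ)) ^ 2 * (‖X (redVec m)‖ ^ 2 * ‖redVec n‖ ^ 2) := by
      rw [div_pow]
      have h1θ2 : 0 < (1 - 3 * θ) ^ 2 := pow_pos h1θ 2
      rw [div_mul_eq_mul_div, le_div_iff₀ h1θ2]
      nlinarith [mul_le_mul_of_nonneg_left hB (by positivity : (0 : ℝ) ≤ (1 + 3 * θ) ^ 2 * ‖redVec n‖ ^ 2)]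
    exact h1.trans h2
  calc ‖X (redVec n)‖ ^ 2 * ‖redVec m‖ ^ 2
      ≤ ((1 + 3 * θ) / (1 - 3 * θ)) ^ 2 * (‖X (redVec m)‖ ^ 2 * ‖redVec n‖ ^ 2) := key
    _ = ((1 + 3 * θ) / (1 - 3 * θ)) ^ 2 * (‖X (redVec m)‖ ^ 2 / chartScale X ^ 2 * ‖redVec n‖ ^ 2) * chartScale X ^ 2 := by
        field_simp

/-! ## §6 The two window-independent obligations of the chart dictionary, for every window at once -/

/-- `scale_pos` of `…RadialGlue.ChartDictionary` for the chart `(gramChart, chartScale)`: from `FarWindowData θ θ' w X` with `3θ < 1`.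
[this file] -/
theorem scale_pos_of_farWindowData {θ θ' : ℝ} (hθ : 3 * θ < 1) {w : Fin 6 → ℤ} {X : E3 →ₗ[ℝ] E3}
    (hX : FarWindowData θ θ' w X) : 0 < chartScale X :=
  chartScale_pos_of_near hθ hX.2.1

/-- `mem_K` of `…RadialGlue.ChartDictionary` for the chart `(gramChart, chartScale)` and the region `KRegion ((1+3θ)/(1−3θ))²`: from
`FarWindowData θ θ' w X` with `3θ < 1`. [this file] -/
theorem mem_K_of_farWindowData {θ θ' : ℝ} (hθ : 3 * θ < 1) {w : Fin 6 → ℤ} {X : E3 →ₗ[ℝ] E3}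
    (hX : FarWindowData θ θ' w X) : gramChart X ∈ KRegion (((1 + 3 * θ) / (1 - 3 * θ)) ^ 2) :=
  gramChart_mem_KRegion hθ hX.2.1

/-- The record instance: at `θ = 1/25` the cap is `(28/22)² = 196/121`. [formal bookkeeping] -/
theorem mem_K_record {θ' : ℝ} {w : Fin 6 → ℤ} {X : E3 →ₗ[ℝ] E3} (hX : FarWindowData (1 / 25) θ' w X) :
    gramChart X ∈ KRegion (196 / 121) := by
  have h := mem_K_of_farWindowData (by norm_num) hX
  norm_num at h
  exact h

end Summit.AtomisticToContinuum.Crystallization.Theorems.OverbindingBudgetAffineRadialChart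

end
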